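import Literature.MathematicalPhysics.QuantumFieldTheory.Balaban1983to89.Node00.LocalGaugeCoDivergenceLetters
import Literature.MathematicalPhysics.QuantumFieldTheory.Balaban1983to89.Node00.CoDivergenceExpansion
import Literature.MathematicalPhysics.QuantumFieldTheory.Balaban1983to89.B15Eq177ValueInvarianceCoDiv

/-!
# NODE 00 — [15] (168)'s SECOND CLAUSE AT THE OBJECTS OF RECORD ([6] Prop. 7: (1.140) ⇒ (1.142) at the trivial background, ∃-gauge form): a local gauge with
# `|A|, |∇^ξA| < t` and the second-order letter `|∂^{ξ*}∂^ξA| < t` on a site set `Y` BOUNDS THE CO-DIVERGENCE `η·(D^{η*}_U∂U)(b)` on the deep bonds of `Y` by `2·t·ξ³`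

Cell `pub-ymgap`, seat `pub-ymgap-dag-n07-e` generation 13 (R141 (C), DAG node N07 = [15]; cell INBOX INTENT-33 ∕ DECL-DELTA-33 of 2026-08-27).  NEW leaf, PROOF kind
(no `def`); this seat's companions `Node00.LocalGaugeCoDivergenceLetters` (33b: `Sect2.curlA`, `Sect2.codiffCurlA`, `Sect2.plaqExponents`, `Sect2.bondsDeep`,
`Sect2.LocalGauge10On` and their bookkeeping) and `Node00.CoDivergenceExpansion` (33a: the Banach-algebra side of [6] (1.54) and the budget), dag-n12-c's
`B15Eq177ValueInvarianceCoDiv` (`norm_coDivSum_gaugeAct`: the operator norm of the co-divergence is gauge invariant), node00-def-P11's `Node00.Record12BgRowCoDiv`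
(`Sect2.coDivTerm`, `Sect2.coDivSum`, `Sect2.CoDivSmallOn`) and module 31 `Node00.LocalGaugePlaquette` (`plaqSmallOn_of_localGaugeOn`) CONSUMED BY NAME, nothing
modified.  `--supports stmt-QuantumFields-20541` (K0⁷).  [15] = [Balaban1985Variational]; [6] = [Balaban1985RegularSpaces]; [I] = [Balaban1987RG1].

WHY.  Print's LAST STEP of [15] Sect. F ((168) p. 304): *«… This [(167)] and the inequality (1.54) of [6] imply |U₁(∂p) − 1| < ε′ + 86dε′² < 2ε′ on Δ₀ (168) for ε′
small, similarly for |D^{η*}∂U₁|.  Again using the fact that U₁ is a gauge transformed U′_k on Δ₀ and that the conditions (2) are gauge invariant, we conclude that U′_k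
satisfies (2) on Δ₀ with max{B₃ε₁, ½ε₀} instead of ε₀»*; and [6] Sect. G Prop. 7 p. 100: from (1.139) `U₀ ∈ U_k({Ω_j}, α₀)` and (1.140) `(L^jη)|A|, (L^jη)²|D^η_{U₀}A|,
(L^jη)³|D^{η*}_{U₀}D^η_{U₀}A| < α₂ on Ω_j`, *«The basic estimate (1.54) and the assumptions imply»* (1.142), the (1.9)-member for `U₁U₀`, `U₁ = e^{iηA}`, at `α₀ + 3α₂`.
Module 31 kernel-checked the PLAQUETTE member (1.7) from def-P11's clause `Sect2.LocalGaugeOn` (`|A|, |∇^ξA|` only); dag-ref-G READ213 NOTE-2 recorded that the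
CO-DIVERGENCE member (1.9) was not in the tree.  This file proves it at NODE 00's objects, at the trivial background `U₀ ≡ 1` (the case of (168): `U₁ = (U′_k)^u` itself
is `e^{iηA}`), from the clause `Sect2.LocalGauge10On` of 33b which adds print's (10)-letter `∂^{ξ*}∂^ξA` — the letter the linear part of the co-divergence IS.

THE PROOF (all in kernel).  Gauge invariance (`norm_coDivSum_gaugeAct`) passes to `U^u` with `ι(U^u(b)) = e^{iξA(b)}` on the bonds of `Y`.  For a deep bond `⟨x, x+e_μ⟩`
and a direction `ν`, the `ν`-term of `η·D^{η*}∂U^u` is `e^{−iξA_ν(x−e_ν)}·(∂U^u)(p(x−e_ν))·e^{iξA_ν(x−e_ν)} − (∂U^u)(p(x))`, the two plaquette variables being ordered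
products of four exponents of size `≤ ξt` (33b `plaqMat_gaugeAct_eq_holonomy`) whose exponents differ termwise by `≤ ξ²t` (translation by `e_ν`, stencil bounds) and
whose exponent SUMS are `iξ·ξ·(∂^ξA)(p)` of size `≤ 2ξ²t`.  33a's `norm_transport_holonomy_sub_linear_le` writes the term as the difference of the exponent sums —
`iξ·ξ·[(∂^ξA)(p(x−e_ν)) − (∂^ξA)(p(x))]` — plus three errors (transport `O(ξt)·‖∂U − 1‖ = O(ξ³t²)` because `‖∂U − 1‖ = O(ξ²t)`, NOT `O(ξt)`; the quadratic vertex
`quad`, Lipschitz in the exponents: `4²·ξt·ξ²t`; two cubic tails), closed by `coDivBudget` at `32·ξ³t²` per direction (`0 < ξ ≤ 1`, `32t ≤ 1`).  Summing over `ν`, the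
linear parts assemble to `iξ³·(∂^{ξ*}∂^ξA)(x, x+e_μ)` (antisymmetry of `∂^ξA` folds the two orientations of `Sect2.coDivSum`; the `ν = μ` term vanishes on both sides):
`‖η·D^{η*}∂U(x, x+e_μ)‖ ≤ ξ³·‖(∂^{ξ*}∂^ξA)(x, x+e_μ)‖ + d·32·ξ³t²`, hence `< 2tξ³` under the clause's `‖∂^{ξ*}∂^ξA‖ < t` and `32·d·t ≤ 1`.

CONTENTS.  §1 ★ `Sect2.norm_coDivTerm_sub_linear_le` (one direction: `‖coDivTerm (U^u) x ν α β − iξ·ξ·((∂^ξA)(p_{αβ}(x−e_ν)) − (∂^ξA)(p_{αβ}(x)))‖ ≤ 32ξ³t²`, the eight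
sites of the two plaquettes in `Y`).  §2 ★★ `Sect2.norm_coDivSum_le_of_localGauge_letters` (explicit `u`, `A`: `‖η·D^{η*}_U∂U(b)‖ ≤ ξ³‖(∂^{ξ*}∂^ξA)(b)‖ + d·(32ξ³t²)` on
`b ∈ bondsDeep Y`), ★★ `Sect2.coDivSmallOn_of_localGauge10On` (`Sect2.LocalGauge10On Y ξ t U`, `0 < ξ ≤ 1`, `32·d·t ≤ 1` ⇒ `Sect2.CoDivSmallOn (bondsDeep Y) (2·t·ξ³) U`
— [6] (1.142) ∕ [15] (168) second clause), ★ `Sect2.regularTwo_of_localGauge10On` (BOTH members of the class (2) inside `Y`: module 31's (1.7) at `32tξ²` on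
`plaqInside Y` ∧ (1.9) at `2tξ³` on `bondsDeep Y` — print's «U′_k satisfies (2) on Δ₀» ∕ [6] (1.144) at `U₀ ≡ 1`, constants the tree's).

USE.  The interface a discharge of V15 stub 1 (`Prop8RegSepTopStep` ⟺ `HalvingStepTop`, module 30) meets at its last line for the co-divergence half of the class:
(167)'s letters on the collared cube `□̃ ⊃ Δ₀` in the gauge `u` of (152)–(159) ⇒ (2) on `Δ₀` (both members) with `ξ = η_n`, thresholds `32tη_n²` ∕ `2tη_n³`
(print: `2ε′`; the constants are absorbed into the next `ε₀`-budget — dag-ref-G READ213 NOTE-1).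

HONEST FRAMING: kernel lemmas about the tree's own objects (matrix-exponential estimates + gauge invariance); NOTHING of Bałaban's analysis asserted or proved beyond
this elementary step; the clause is a HYPOTHESIS here (no token of the K0 road carries the (10)-letter yet); K0⁷ ∕ V15 stub 1 NOT closed; N07 NOT discharged; counts
unmoved (5∕27); one finite T⁴ programme at fixed ε — NOT continuum ∕ ℝ⁴ ∕ OS ∕ mass gap ∕ Clay.  No `sorry`, no `def`, no `instance`, no `notation`.
-/

noncomputable section

open scoped Matrix.Norms.L2Operator

namespace Literature.MathematicalPhysics.QuantumFieldTheory.Balaban1983to89.Node00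

open Complex (I)
open NormedSpace
open Beta.TransportVertices (holonomy quad size expTail expTail_mono expTail_two_le expTail_three_le size_nonneg size_le_length_mul)
open B15DeterminingSets
open B12RegularSpaces111 (gaugeU expI grad)

variable {P : Params} {N : ℕ} [NeZero N]

omit [NeZero N] in
/-- `(x − e_μ) + e_μ = x` on the torus (elementary). [folklore] -/
private theorem shift_unshift {j : ℕ} (x : Site P j) (μ : Fin P.d) : (x.unshift μ).shift μ = x := by
  funext ν
  by_cases h : ν = μ
  · subst h; simp [Site.shift, Site.unshift]
  · simp [Site.shift, Site.unshift, Function.update_of_ne h]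

/-! ## §1  One direction `ν`: the transported difference of two neighbouring plaquette variables of `U^u = e^{iξA}` -/

section OneDirection

/-- ★ **ONE TERM OF [6] (1.2) FOR `U^u = e^{iξA}` IS ITS LINEAR PART UP TO `32·ξ³t²`** ([6] (1.54) at the trivial background, one direction).  Under the gauge equation
`(ι∘U)^{ι∘u}(b) = e^{iξA(b)}` with `‖A‖ < t` on the bonds of `Y` and `‖∇^ξA‖ < t` on its derivative stencils, `0 < ξ ≤ 1`, `32t ≤ 1`, and with the eight corners of the
plaquettes `p_{αβ}(x)` and `p_{αβ}(x−e_ν)` in `Y`: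
`‖[R((U^u)(x, x−e_ν))(∂U^u)(p_{αβ}(x−e_ν)) − (∂U^u)(p_{αβ}(x))] − iξ·ξ·[(∂^ξA)(p_{αβ}(x−e_ν)) − (∂^ξA)(p_{αβ}(x))]‖ ≤ 32·ξ³·t²`
(33b `plaqMat_gaugeAct_eq_holonomy` ∕ `sum_plaqExponents` ∕ `forall₂_plaqExponents`, 33a `norm_transport_holonomy_sub_linear_le` ∕ `coDivBudget`).
[cite: Balaban1985RegularSpaces, (1.1)–(1.2) p.76, (1.54) p.85; Balaban1985Variational, (168) p.304] -/
theorem Sect2.norm_coDivTerm_sub_linear_le {Y : Set (Site P 0)} {ξ t : ℝ} {u : GaugeTransf P 0 (SU N)} {U : GaugeField P 0 (SU N)}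
    {A : PBond P 0 → MatA N}
    (he : ∀ b ∈ (Sect2.regionOfSet P Y).bonds, gaugeU (fun x => ιSU N (u x)) (fun b' => ιSU N (U b')) b = expI ξ (A b))
    (hA : ∀ b ∈ (Sect2.regionOfSet P Y).bonds, ‖A b‖ < t)
    (hdA : ∀ q ∈ (Sect2.regionOfSet P Y).dpairs, ‖grad ξ q.2.1 (fun y => A ⟨y, q.2.2⟩) q.1‖ < t)
    (hξ : 0 < ξ) (hξ1 : ξ ≤ 1) (ht : 32 * t ≤ 1)
    {x : Site P 0} {ν α β : Fin P.d} (h : α < β)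
    (s0 : x ∈ Y) (sα : x.shift α ∈ Y) (sβ : x.shift β ∈ Y) (sαβ : (x.shift α).shift β ∈ Y)
    (s0' : x.unshift ν ∈ Y) (sα' : (x.unshift ν).shift α ∈ Y) (sβ' : (x.unshift ν).shift β ∈ Y)
    (sαβ' : ((x.unshift ν).shift α).shift β ∈ Y) :
    ‖Sect2.coDivTerm (GaugeField.gaugeAct u U) x ν α β h -
        (I * ξ) • ((ξ : ℂ) • (Sect2.curlA ξ A (x.unshift ν) α β - Sect2.curlA ξ A x α β))‖ ≤ 32 * ξ ^ 3 * t ^ 2 := by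
  have hxx : (x.unshift ν).shift ν = x := shift_unshift x ν
  have ht0 : 0 < t := (norm_nonneg _).trans_lt (hA ⟨x, α⟩ ⟨s0, sα⟩)
  have sβα : (x.shift β).shift α ∈ Y := by rw [← Site.shift_comm]; exact sαβ
  have sβα' : ((x.unshift ν).shift β).shift α ∈ Y := by rw [← Site.shift_comm]; exact sαβ'
  have hxαν : ((x.unshift ν).shift α).shift ν = x.shift α := by rw [← Site.unshift_shift_comm, shift_unshift]
  have hxβν : ((x.unshift ν).shift β).shift ν = x.shift β := by rw [← Site.unshift_shift_comm, shift_unshift]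
  -- the transporting bond variable `U^u(x−e_ν, x) = e^{iξA_ν(x−e_ν)}`
  have hwb : (⟨x.unshift ν, ν⟩ : PBond P 0) ∈ (Sect2.regionOfSet P Y).bonds := ⟨s0', by rw [PBond.tgt, hxx]; exact s0⟩
  have hw : ιSU N (GaugeField.gaugeAct u U ⟨x.unshift ν, ν⟩) = expI ξ (A ⟨x.unshift ν, ν⟩) := by
    rw [ιSU_gaugeAct]; exact he _ hwb
  -- the two plaquette variables as ordered exponential products
  have hP' := Sect2.plaqMat_gaugeAct_eq_holonomy he h s0' sα' sβ' sαβ'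
  have hP := Sect2.plaqMat_gaugeAct_eq_holonomy he h s0 sα sβ sαβ
  set l' := Sect2.plaqExponents ξ A (x.unshift ν) α β with hl'
  set l := Sect2.plaqExponents ξ A x α β with hl
  set c : MatA N := (I * ξ) • A ⟨x.unshift ν, ν⟩ with hc
  have hunit : exp (-c) * exp c = 1 := by
    have h1 : (((expI ξ (A ⟨x.unshift ν, ν⟩))⁻¹ : (MatA N)ˣ) : MatA N) * ((expI ξ (A ⟨x.unshift ν, ν⟩) : (MatA N)ˣ) : MatA N) = 1 :=
      Units.inv_mul _
    exact h1
  have hlin : l'.sum - l.sum = (I * ξ) • ((ξ : ℂ) • (Sect2.curlA ξ A (x.unshift ν) α β - Sect2.curlA ξ A x α β)) := by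
    rw [hl', hl, Sect2.sum_plaqExponents hξ.ne', Sect2.sum_plaqExponents hξ.ne', smul_sub, smul_sub]
  have hcd : Sect2.coDivTerm (GaugeField.gaugeAct u U) x ν α β h = exp (-c) * holonomy l' * exp c - holonomy l := by
    rw [Sect2.coDivTerm, map_inv, hw, hP', hP]
    rfl
  have hrew : Sect2.coDivTerm (GaugeField.gaugeAct u U) x ν α β h -
      (I * ξ) • ((ξ : ℂ) • (Sect2.curlA ξ A (x.unshift ν) α β - Sect2.curlA ξ A x α β)) =
      (exp (-c) * (holonomy l' - 1) * exp c - (holonomy l - 1)) - (l'.sum - l.sum) := by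
    rw [hcd, ← hlin]
    calc exp (-c) * holonomy l' * exp c - holonomy l - (l'.sum - l.sum)
        = (exp (-c) * (holonomy l' - 1) * exp c - (holonomy l - 1)) - (l'.sum - l.sum) + (exp (-c) * exp c - 1) := by
          noncomm_ring
      _ = (exp (-c) * (holonomy l' - 1) * exp c - (holonomy l - 1)) - (l'.sum - l.sum) := by
          rw [hunit, sub_self, add_zero]
  rw [hrew]
  -- the exponents of the two plaquettes differ termwise by `≤ ξ·ξt` (four stencils)
  have hF2 : List.Forall₂ (fun b b' => ‖b' - b‖ ≤ ξ * (ξ * t)) l l' := by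
    have q1 : (x.unshift ν, ν, α) ∈ (Sect2.regionOfSet P Y).dpairs :=
      ⟨s0', show (x.unshift ν).shift ν ∈ Y by rw [hxx]; exact s0, sα',
        show ((x.unshift ν).shift ν).shift α ∈ Y by rw [hxx]; exact sα⟩
    have q2 : ((x.unshift ν).shift α, ν, β) ∈ (Sect2.regionOfSet P Y).dpairs :=
      ⟨sα', show ((x.unshift ν).shift α).shift ν ∈ Y by rw [hxαν]; exact sα, sαβ',
        show (((x.unshift ν).shift α).shift ν).shift β ∈ Y by rw [hxαν]; exact sαβ⟩
    have q3 : ((x.unshift ν).shift β, ν, α) ∈ (Sect2.regionOfSet P Y).dpairs :=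
      ⟨sβ', show ((x.unshift ν).shift β).shift ν ∈ Y by rw [hxβν]; exact sβ, sβα',
        show (((x.unshift ν).shift β).shift ν).shift α ∈ Y by rw [hxβν]; exact sβα⟩
    have q4 : (x.unshift ν, ν, β) ∈ (Sect2.regionOfSet P Y).dpairs :=
      ⟨s0', show (x.unshift ν).shift ν ∈ Y by rw [hxx]; exact s0, sβ',
        show ((x.unshift ν).shift ν).shift β ∈ Y by rw [hxx]; exact sβ⟩
    have := Sect2.forall₂_plaqExponents hξ hdA q1 q2 q3 q4
    rwa [hxx] at this
  -- sizes, the exponent sum of the transported plaquette, the transport letter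
  have hsz' : size l' ≤ 4 * (ξ * t) := by
    have := size_le_length_mul l' (Sect2.norm_le_of_mem_plaqExponents hξ.le hA s0' sα' sβ' sαβ')
    rwa [Sect2.length_plaqExponents] at this
  have hsz : size l ≤ 4 * (ξ * t) := by
    have := size_le_length_mul l (Sect2.norm_le_of_mem_plaqExponents hξ.le hA s0 sα sβ sαβ)
    rwa [Sect2.length_plaqExponents] at this
  have hsum' : ‖l'.sum‖ ≤ 2 * ξ ^ 2 * t :=
    Sect2.norm_sum_plaqExponents_le hξ hdA ⟨s0', sα', sβ', sαβ'⟩ ⟨s0', sβ', sα', sβα'⟩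
  have hξt : 0 ≤ ξ * t := mul_nonneg hξ.le ht0.le
  have hcn : ‖c‖ ≤ ξ * t := by
    rw [hc, B12Membership314.norm_I_mul_smul hξ.le]; exact mul_le_mul_of_nonneg_left (hA _ hwb).le hξ.le
  -- the three errors of `norm_transport_holonomy_sub_linear_le`
  have hE1 : Real.exp ‖c‖ ^ 2 - 1 ≤ Real.exp (ξ * t) ^ 2 - 1 := by
    have := Real.exp_le_exp.mpr hcn
    nlinarith [Real.exp_pos ‖c‖]
  have hE0 : 0 ≤ Real.exp ‖c‖ ^ 2 - 1 := by nlinarith [Real.one_le_exp (norm_nonneg c)]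
  have hH' : ‖holonomy l' - 1‖ ≤ 2 * ξ ^ 2 * t + (4 * (ξ * t)) ^ 2 / 2 * Real.exp (4 * (ξ * t)) :=
    (norm_holonomy_sub_one_le_sum_add l').trans (add_le_add hsum'
      ((expTail_mono 2 (size_nonneg l') hsz').trans (expTail_two_le (by positivity))))
  have T1 : ‖holonomy l' - 1‖ * (Real.exp ‖c‖ ^ 2 - 1) ≤
      (2 * ξ ^ 2 * t + (4 * (ξ * t)) ^ 2 / 2 * Real.exp (4 * (ξ * t))) * (Real.exp (ξ * t) ^ 2 - 1) :=
    mul_le_mul hH' hE1 hE0 ((norm_nonneg _).trans hH')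
  have T2 : ‖quad ℂ l' - quad ℂ l‖ ≤ (4 : ℝ) ^ 2 * (ξ * t) * (ξ * (ξ * t)) := by
    have := norm_quad_sub_quad_le_of_forall₂ hξt (by positivity) hF2
      (Sect2.norm_le_of_mem_plaqExponents hξ.le hA s0 sα sβ sαβ) (Sect2.norm_le_of_mem_plaqExponents hξ.le hA s0' sα' sβ' sαβ')
    rw [hl, Sect2.length_plaqExponents] at this
    simpa using this
  have T3 : expTail 3 (size l') + expTail 3 (size l) ≤ 2 * ((4 * (ξ * t)) ^ 3 / 6 * Real.exp (4 * (ξ * t))) := by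
    have h3' := (expTail_mono 3 (size_nonneg l') hsz').trans (expTail_three_le (by positivity))
    have h3 := (expTail_mono 3 (size_nonneg l) hsz).trans (expTail_three_le (by positivity))
    linarith
  have hB := coDivBudget hξ hξ1 ht0.le ht
  have hmain := norm_transport_holonomy_sub_linear_le c l l'
  have e2 : (4 : ℝ) ^ 2 * (ξ * t) * (ξ * (ξ * t)) = (4 : ℝ) ^ 2 * (ξ * t) * (ξ ^ 2 * t) := by ring
  linarith

end OneDirection

/-! ## §2  ★★ The co-divergence member (1.9) from the letters ([6] Prop. 7 (1.142) ∕ [15] (168) second clause at the objects of record) -/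

section CoDivergence

/-- ★★ **[6] (1.54) ⇒ (1.142) AT THE TRIVIAL BACKGROUND, AT NODE 00's OBJECTS, EXPLICIT LETTERS.**  If `(ι∘U)^{ι∘u} = e^{iξA}` on the bonds of `Y` with `‖A‖ < t` there and
`‖∇^ξA‖ < t` on the derivative stencils of `Y` (`0 < ξ ≤ 1`, `32t ≤ 1`), then on every deep bond `b = ⟨x, x+e_μ⟩` of `Y`
`‖η·(D^{η*}_U∂U)(b)‖ ≤ ξ³·‖(∂^{ξ*}∂^ξA)(b)‖ + d·(32·ξ³·t²)`: the co-divergence of `U` (gauge invariant: dag-n12-c's `norm_coDivSum_gaugeAct`) is `iξ³` times print's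
second-order letter up to the summed per-direction errors of §1 (antisymmetry of `∂^ξA` folds the two orientations of `Sect2.coDivSum`; the `ν = μ` term is `0` on both
sides and is majorised with the others). [cite: Balaban1985RegularSpaces, (1.2) p.76, (1.54) p.85, (1.140)–(1.142) p.100; Balaban1985Variational, (168) p.304] -/
theorem Sect2.norm_coDivSum_le_of_localGauge_letters {Y : Set (Site P 0)} {ξ t : ℝ} {U : GaugeField P 0 (SU N)}
    (u : GaugeTransf P 0 (SU N)) (A : PBond P 0 → MatA N)
    (he : ∀ b ∈ (Sect2.regionOfSet P Y).bonds, gaugeU (fun x => ιSU N (u x)) (fun b' => ιSU N (U b')) b = expI ξ (A b))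
    (hA : ∀ b ∈ (Sect2.regionOfSet P Y).bonds, ‖A b‖ < t)
    (hdA : ∀ q ∈ (Sect2.regionOfSet P Y).dpairs, ‖grad ξ q.2.1 (fun y => A ⟨y, q.2.2⟩) q.1‖ < t)
    (hξ : 0 < ξ) (hξ1 : ξ ≤ 1) (ht : 32 * t ≤ 1) {b : PBond P 0} (hb : b ∈ Sect2.bondsDeep Y) :
    ‖Sect2.coDivSum U b.src b.dir‖ ≤
      ξ ^ 3 * ‖Sect2.codiffCurlA ξ A b.src b.dir‖ + P.d * (32 * ξ ^ 3 * t ^ 2) := by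
  obtain ⟨x, μ⟩ := b
  obtain ⟨hx, hxμ, hnb⟩ := hb
  simp only [PBond.tgt] at hxμ hnb
  change x.shift μ ∈ Y at hxμ
  rw [← B15Eq177ValueInvarianceCoDiv.norm_coDivSum_gaugeAct u U x μ]
  have ht0 : 0 < t := (norm_nonneg _).trans_lt (hA ⟨x, μ⟩ ⟨hx, hxμ⟩)
  have hξ' : (ξ : ℂ) ≠ 0 := Complex.ofReal_ne_zero.mpr hξ.ne'
  set D : Fin P.d → MatA N := fun ν => (ξ : ℂ)⁻¹ • (Sect2.curlA ξ A (x.unshift ν) ν μ - Sect2.curlA ξ A x ν μ) with hD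
  have hcod : Sect2.codiffCurlA ξ A x μ = ∑ ν, D ν := rfl
  have hDν : ∀ ν, (ξ : ℂ) • D ν = Sect2.curlA ξ A (x.unshift ν) ν μ - Sect2.curlA ξ A x ν μ := fun ν =>
    smul_inv_smul₀ hξ' _
  -- every direction: the summand of `coDivSum (U^u)` minus `iξ³·D ν` is `≤ 32ξ³t²`
  have hT : ∀ ν : Fin P.d,
      ‖(if h : ν < μ then Sect2.coDivTerm (GaugeField.gaugeAct u U) x ν ν μ h
        else if h' : μ < ν then -Sect2.coDivTerm (GaugeField.gaugeAct u U) x ν μ ν h' else 0) -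
        (I * ξ) • ((ξ : ℂ) • ((ξ : ℂ) • D ν))‖ ≤ 32 * ξ ^ 3 * t ^ 2 := by
    intro ν
    obtain ⟨s1, s2, s3, s4⟩ := hnb ν
    change (x.shift μ).shift ν ∈ Y at s3
    change (x.shift μ).unshift ν ∈ Y at s4
    have s3' : (x.shift ν).shift μ ∈ Y := by rw [Site.shift_comm]; exact s3
    have s4' : (x.unshift ν).shift μ ∈ Y := by rw [← Site.unshift_shift_comm]; exact s4
    have s5 : (x.unshift ν).shift ν ∈ Y := by rw [shift_unshift]; exact hx
    rw [hDν ν]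
    by_cases h1 : ν < μ
    · rw [dif_pos h1]
      exact Sect2.norm_coDivTerm_sub_linear_le he hA hdA hξ hξ1 ht h1 hx s1 hxμ s3' s2 s5 s4'
        (by rw [shift_unshift]; exact hxμ)
    · by_cases h2 : μ < ν
      · rw [dif_neg h1, dif_pos h2]
        have hm := Sect2.norm_coDivTerm_sub_linear_le he hA hdA hξ hξ1 ht h2 hx hxμ s1 s3 s2 s4' s5
          (by rw [← Site.unshift_shift_comm, shift_unshift]; exact hxμ)
        rw [Sect2.curlA_swap ξ A (x.unshift ν) μ ν, Sect2.curlA_swap ξ A x μ ν,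
          show -Sect2.coDivTerm (GaugeField.gaugeAct u U) x ν μ ν h2 -
              (I * ξ) • ((ξ : ℂ) • (-Sect2.curlA ξ A (x.unshift ν) μ ν - -Sect2.curlA ξ A x μ ν)) =
            -(Sect2.coDivTerm (GaugeField.gaugeAct u U) x ν μ ν h2 -
              (I * ξ) • ((ξ : ℂ) • (Sect2.curlA ξ A (x.unshift ν) μ ν - Sect2.curlA ξ A x μ ν))) by
            simp only [smul_sub, smul_neg]; abel,
          norm_neg]
        exact hm
      · have hνμ : ν = μ := le_antisymm (not_lt.mp h2) (not_lt.mp h1)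
        rw [dif_neg h1, dif_neg h2, hνμ, Sect2.curlA_self, Sect2.curlA_self, sub_self, smul_zero, smul_zero, sub_self,
          norm_zero]
        positivity
  have hmain := norm_sum_le_of_termwise _ (fun ν => (I * ξ) • ((ξ : ℂ) • ((ξ : ℂ) • D ν))) hT
  have hg : ‖∑ ν, (I * ξ) • ((ξ : ℂ) • ((ξ : ℂ) • D ν))‖ = ξ ^ 3 * ‖Sect2.codiffCurlA ξ A x μ‖ := by
    rw [← Finset.smul_sum, ← Finset.smul_sum, ← Finset.smul_sum, ← hcod, B12Membership314.norm_I_mul_smul hξ.le,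
      norm_smul, norm_smul, Complex.norm_real, Real.norm_of_nonneg hξ.le]
    ring
  rw [hg, Fintype.card_fin] at hmain
  unfold Sect2.coDivSum
  exact hmain

/-- ★★ **[15] (168), SECOND CLAUSE, AT THE OBJECTS OF RECORD ∕ [6] Prop. 7 (1.142) at the trivial background**: a local gauge on `Y` with `‖A‖, ‖∇^ξA‖ < t` and the
second-order letter `‖∂^{ξ*}∂^ξA‖ < t` on the deep bonds (`Sect2.LocalGauge10On Y ξ t U`), with `0 < ξ ≤ 1` and `32·d·t ≤ 1`, gives the CO-DIVERGENCE member (1.9) of the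
class (2) on the deep bonds of `Y` at threshold `2·t·ξ³`: `Sect2.CoDivSmallOn (bondsDeep Y) (2·t·ξ³) U` (print: `ε′·(1 + O(dε′)) < 2ε′`; here `t·(1 + 32dt) ≤ 2t`).
[cite: Balaban1985Variational, (168) p.304, (2) p.278; Balaban1985RegularSpaces, (1.9) p.77, (1.54) p.85, Prop. 7 (1.140)–(1.142) p.100] -/
theorem Sect2.coDivSmallOn_of_localGauge10On {Y : Set (Site P 0)} {ξ t : ℝ} {U : GaugeField P 0 (SU N)}
    (h : Sect2.LocalGauge10On Y ξ t U) (hξ : 0 < ξ) (hξ1 : ξ ≤ 1) (hd : 32 * P.d * t ≤ 1) :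
    Sect2.CoDivSmallOn (Sect2.bondsDeep Y) (2 * t * ξ ^ 3) U := by
  obtain ⟨u, A, he, hA, hdA, h10⟩ := h
  intro b hb
  have ht0 : 0 < t := (norm_nonneg _).trans_lt (hA b ⟨hb.1, hb.2.1⟩)
  have hd1 : (1 : ℝ) ≤ P.d := by exact_mod_cast P.hd
  have ht32 : 32 * t ≤ 1 := by nlinarith
  have hm := Sect2.norm_coDivSum_le_of_localGauge_letters u A he hA hdA hξ hξ1 ht32 hb
  have h10b := h10 b hb
  have hξ3 : 0 < ξ ^ 3 := pow_pos hξ 3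
  have herr : (P.d : ℝ) * (32 * ξ ^ 3 * t ^ 2) ≤ ξ ^ 3 * t := by
    have h1 := mul_le_mul_of_nonneg_left hd (by positivity : (0 : ℝ) ≤ ξ ^ 3 * t)
    calc (P.d : ℝ) * (32 * ξ ^ 3 * t ^ 2) = ξ ^ 3 * t * (32 * P.d * t) := by ring
      _ ≤ ξ ^ 3 * t * 1 := h1
      _ = ξ ^ 3 * t := mul_one _
  have hlin : ξ ^ 3 * ‖Sect2.codiffCurlA ξ A b.src b.dir‖ < ξ ^ 3 * t := mul_lt_mul_of_pos_left h10b hξ3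
  calc ‖Sect2.coDivSum U b.src b.dir‖ ≤ _ := hm
    _ < ξ ^ 3 * t + ξ ^ 3 * t := add_lt_add_of_lt_of_le hlin herr
    _ = 2 * t * ξ ^ 3 := by ring

/-- ★ **BOTH MEMBERS OF THE CLASS (2) INSIDE `Y` FROM THE LETTERS** — print's «we conclude that U′_k satisfies (2) on Δ₀» ∕ [6] (1.144) `U₁U₀ ∈ U_k({Ω_j}, α₀ + 3α₂)` at
`U₀ ≡ 1`: `Sect2.LocalGauge10On Y ξ t U`, `0 < ξ ≤ 1`, `32·d·t ≤ 1` give the plaquette member (1.7) `PlaqSmallOn (plaqInside Y) (32·t·ξ²) U` (module 31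
`plaqSmallOn_of_localGaugeOn`) AND the co-divergence member (1.9) `Sect2.CoDivSmallOn (bondsDeep Y) (2·t·ξ³) U`.
[cite: Balaban1985Variational, (2) p.278, (168) p.304; Balaban1985RegularSpaces, (1.7)–(1.9) p.77, Prop. 7 (1.144) p.100] -/
theorem Sect2.regularTwo_of_localGauge10On {Y : Set (Site P 0)} {ξ t : ℝ} {U : GaugeField P 0 (SU N)}
    (h : Sect2.LocalGauge10On Y ξ t U) (hξ : 0 < ξ) (hξ1 : ξ ≤ 1) (hd : 32 * P.d * t ≤ 1) :
    PlaqSmallOn (plaqInside Y) (32 * t * ξ ^ 2) U ∧ Sect2.CoDivSmallOn (Sect2.bondsDeep Y) (2 * t * ξ ^ 3) U := by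
  have hd1 : (1 : ℝ) ≤ P.d := by exact_mod_cast P.hd
  have ht32 : 32 * t ≤ 1 := by
    by_cases ht : 0 ≤ t
    · nlinarith
    · linarith
  exact ⟨plaqSmallOn_of_localGaugeOn h.toLocalGaugeOn hξ hξ1 ht32, Sect2.coDivSmallOn_of_localGauge10On h hξ hξ1 hd⟩

end CoDivergence

end Literature.MathematicalPhysics.QuantumFieldTheory.Balaban1983to89.Node00

end
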